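import Summits.Ventures.CertifiedArithmetic.LowPrec.DoubleRoundingFMAWideCore

/-!
# Double rounding of the FMA through a register with `P_ψ = 3 P_φ - 1` — the test and the integer core

HONEST FRAMING: certified error envelopes and provably optimal rounding/accumulation schemes for
low-precision formats under stated cost models; every table by two implementations; no hardware
or vendor claims.

THEOREM D-fma-W′ (`DoubleRoundingFMANearWide.lean`: soundness; the `Witness` and `Iff` files:
the three slip patterns as explicit triples, the criterion as an `iff`, named cells) decides
`DFma φ ψ` for the NEAR-WIDE column `P_ψ = 3 P_φ - 1`, the one column between clause F's window
theorems and THEOREM D-fma-W (`P_ψ ≥ 3 P_φ`, `DoubleRoundingFMAWideCore.lean`).  In the units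
`ν = quantum ψ / 2` of `fma_slip_core` a slip has `fl_ψ (ab + c) = μ = (2V'+1)·2^g`, a midpoint
of `φ`, `0 < |ab + c - μ| ≤ 2^t` (`2^(t+1) ν` = the spacing of `ψ` at `μ`), the addend outside
the gap (`|c - μ| ≥ 2^g`), and at this column `g = t + 2P_φ - 1` exactly (or `g ≥ t + 2P_φ`,
D-fma-W's regime, when the lower neighbour of `μ` is subnormal).  The integer core
`fma_slip_core_nearWide` leaves THREE patterns (D-fma-W had one):

* (A1) `ab = μ`: the significand `2V'+1 = a₁·b₁` is composite — `sigPairTest`, as in D-fma-W;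
* (A2) `ab = μ - ρ·2^(t+P) ν`, `c = ρ·(2^P - 1)·2^t ν` (`ρ = ±1`): the sum is a TIE of `ψ`
  resolved onto the (even) midpoint; `(2V'+1)·2^(P-1) - ρ = a₁·b₁` — `twoSigTest` of
  `fmaTieSig` —, and the direction forces the parity of `V'` (`ρ = +1`: `V'` odd);
* (B′) `c = μ ∓ 2^g ν` is a NEIGHBOUR of `μ` in `φ` and `|ab| = 2^g ν ± 2^t ν` is half the
  spacing of `φ` up to half the spacing of `ψ`, again a tie of `ψ`: `a₁·b₁ = 2^(2P-1) ± 1` —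
  pure number theory of `P` (`9 = 3·3`, `513 = 19·27`, `32767 = 151·217`, …) — realizable in
  every binade whose half-spacing of `ψ` is at least `quantum φ ²`.

This file: the Boolean tests (`twoSigTest`, `fmaTieSig`, `fmaNearWideATest`, `fmaNearWideBTest`,
`fmaNearWideTest`, `dFmaNearWideTest`), `twoSigTest_mul_eq_true`, and the integer core.
Implementation A = `code/enum/fma_nearwide_law.py` (certificate `DOUBLE-ROUNDING-FMA-NEARWIDE.json`).

References: [MartinDorelMelquiondMuller2013] Property 2.1 (a slip forces a midpoint);
[BoldoMelquiond2008] Thm 3 (parity along the grid); [Figueroa1995] §3; [Roux2014] §2.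
No hardware or vendor claims.
-/

namespace Summit.Ventures.CertifiedArithmetic

open Literature.ComputerArithmetic.FloatingPoint
open Literature.ComputerArithmetic.FloatingPoint.Format
open Literature.ComputerArithmetic.FloatingPoint.MiniFloat

/-! ## §1 The test -/

/-- `twoSigTest P n`: `n = a·b` with `0 < a < 2^P` and `b < 2^P` — `n` is a product of two
`P`-digit significands (a bounded divisor search the kernel evaluates). [this packet] -/
def twoSigTest (P n : ℕ) : Bool :=
  (List.range (2 ^ P)).any fun a => decide (0 < a) && decide (n % a = 0) && decide (n < a * 2 ^ P)

/-- The A2 number of the midpoint above the significand `t` of an `(m+1)`-digit format: the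
product significand `(2t+1)·2^m - 1` when `t` is odd (the sum approaches the midpoint from
below, the slip needs the upper neighbour `t + 1` to be even), `(2t+1)·2^m + 1` when `t` is
even. [this packet] -/
def fmaTieSig (m t : ℕ) : ℕ :=
  if t % 2 = 1 then (2 * t + 1) * 2 ^ m - 1 else (2 * t + 1) * 2 ^ m + 1

/-- `fmaNearWideATest φ ψ`: no midpoint of `φ` available in the binade `2^(m_ψ+1)` quanta
(`fmaWideCount` of them, as in D-fma-W) has a composite significand (A1, `sigPairTest`) or a
two-significand A2 number (`twoSigTest (fmaTieSig …)`). [this packet] -/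
def fmaNearWideATest (φ ψ : Format) : Bool :=
  (List.range (fmaWideCount φ ψ)).all fun j =>
    ! sigPairTest (φ.manBits + 1) (2 ^ (φ.manBits + 1) + 2 * j + 1)
      && ! twoSigTest (φ.manBits + 1) (fmaTieSig φ.manBits (2 ^ φ.manBits + j))

/-- `fmaNearWideBTest φ` (a function of the source record alone): NOT both "`2^(2P-1) - 1` or
`2^(2P-1) + 1` is a product of two `P`-digit significands" and "the second value
`(2^m + 1)·2^(k₀+1)` quanta of the binade `k₀ = (m + 2) ∸ bias` of the midpoint frame is finite"
(`(2^m+1)·2^((m+3) - bias) ≤ maxScaled`, truncated subtraction). [this packet] -/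
def fmaNearWideBTest (φ : Format) : Bool :=
  !((twoSigTest (φ.manBits + 1) (2 ^ (2 * (φ.manBits + 1) - 1) - 1)
      || twoSigTest (φ.manBits + 1) (2 ^ (2 * (φ.manBits + 1) - 1) + 1))
    && decide ((2 ^ φ.manBits + 1) * 2 ^ (φ.manBits + 3 - φ.bias) ≤ φ.maxScaled))

/-- `fmaNearWideTest φ ψ`: the A-part and the B′-part. [this packet] -/
def fmaNearWideTest (φ ψ : Format) : Bool :=
  fmaNearWideATest φ ψ && fmaNearWideBTest φ

/-- THEOREM D-fma-W′ as ONE Boolean test on parameter records (the hypotheses of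
`dFma_of_fmaNearWideTest`). [this packet] -/
def dFmaNearWideTest (φ ψ : Format) : Bool :=
  embedsTest φ ψ && decide (ψ.manBits = 3 * φ.manBits + 1) && decide (φ.bias ≤ ψ.bias)
    && decide (ψ.qexp ≤ 2 * φ.qexp) && decide (ψ.qexp + ψ.manBits + 1 ≤ φ.qexp)
    && decide (1 ≤ φ.manBits) && fmaNearWideTest φ ψ

/-- A product `a·b` with `0 < a < 2^P`, `b < 2^P` passes `twoSigTest P`. [folklore] -/
theorem twoSigTest_mul_eq_true {P a b : ℕ} (ha : 0 < a) (ha' : a < 2 ^ P) (hb : b < 2 ^ P) :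
    twoSigTest P (a * b) = true := by
  unfold twoSigTest
  rw [List.any_eq_true]
  refine ⟨a, List.mem_range.mpr ha', ?_⟩
  have h1 : a * b % a = 0 := Nat.mul_mod_right a b
  have h2 : a * b < a * 2 ^ P := Nat.mul_lt_mul_of_pos_left hb ha
  simp [ha, h1, h2]

/-- `fmaTieSig m t` in closed form: `(2t+1)·2^m - ρ` with `ρ = 1` for odd `t`, `ρ = -1` for even
`t` (as an integer). [this packet] -/
theorem fmaTieSig_eq (m t : ℕ) :
    ((fmaTieSig m t : ℕ) : ℤ) = (2 * t + 1) * 2 ^ m - (if t % 2 = 1 then 1 else -1) := by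
  unfold fmaTieSig
  have h1 : 1 ≤ (2 * t + 1) * 2 ^ m := Nat.one_le_iff_ne_zero.mpr (by positivity)
  split_ifs with h
  · push_cast [Nat.cast_sub h1]; ring
  · push_cast; ring

/-! ## §2 The integer core -/

/-- THE INTEGER HEART OF THEOREM D-fma-W′. Units: half a quantum of the wide format. A product
`P` with `2^k ∣ P`, `|P| ≤ (2^p-1)²·2^k` (`p ≥ 2` digits), an addend `C` with `|C| = c₁·2^γ`,
`c₁ < 2^p`, that is either coarse (`2^(t+1) ∣ C`) or small (`|C| ≤ (2^p-1)·2^t`), a midpoint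
`M = (2J+1)·2^g ≥ 2^(g+p)` with `g = t + 2p - 1` that is the correctly rounded wide result
(`0 < |P + C - M| ≤ 2^t`) with the addend outside the gap (`|C - M| ≥ 2^g`).  Then exactly one
of: (A1) `P = M`; (A2) `P = M - ρ·2^(t+p)`, `C = ρ·(2^p-1)·2^t`, `ρ = ±1`; (B′) `C = M + σ·2^g`,
`P = -σ·2^g + ε·2^t`, `k = t`, `σ, ε = ±1`. [this packet] -/
theorem fma_slip_core_nearWide {p k t g γ : ℕ} {P C M J c₁ : ℤ} (hp : 2 ≤ p)
    (hkP : (2:ℤ) ^ k ∣ P) (hPle : |P| ≤ ((2:ℤ) ^ p - 1) ^ 2 * 2 ^ k)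
    (hC1 : |C| = c₁ * 2 ^ γ) (hc₁ : c₁ < (2:ℤ) ^ p)
    (hC : (2:ℤ) ^ (t + 1) ∣ C ∨ |C| ≤ ((2:ℤ) ^ p - 1) * 2 ^ t) (hM : M = (2 * J + 1) * 2 ^ g)
    (hg : g + 1 = t + 2 * p) (hMge : (2:ℤ) ^ (g + p) ≤ M)
    (hN0 : P + C - M ≠ 0) (hNle : |P + C - M| ≤ (2:ℤ) ^ t) (hfar : (2:ℤ) ^ g ≤ |C - M|) :
    P = M ∨ (∃ ρ : ℤ, (ρ = 1 ∨ ρ = -1) ∧ P = M - ρ * 2 ^ (t + p) ∧ C = ρ * (2 ^ p - 1) * 2 ^ t)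
      ∨ (∃ σ ε : ℤ, (σ = 1 ∨ σ = -1) ∧ (ε = 1 ∨ ε = -1) ∧ C = M + σ * 2 ^ g
          ∧ P = -σ * 2 ^ g + ε * 2 ^ t ∧ k = t) := by
  have h4p : (4:ℤ) ≤ 2 ^ p := by
    calc (4:ℤ) = 2 ^ 2 := by norm_num
      _ ≤ 2 ^ p := pow_le_pow_right₀ (by norm_num) hp
  have ht0 : (0:ℤ) < 2 ^ t := by positivity
  have hp0 : (0:ℤ) < 2 ^ p := by positivity
  have hg0 : (0:ℤ) < 2 ^ g := by positivity
  have hγ0 : (0:ℤ) < 2 ^ γ := by positivity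
  have hk0 : (0:ℤ) < 2 ^ k := by positivity
  -- `2^(g+1) = 2^t · (2^p)^2`
  have eg1 : (2:ℤ) ^ (g + 1) = 2 ^ t * (2 ^ p * 2 ^ p) := by
    rw [hg, pow_add, pow_mul', sq]
  have egp : (2:ℤ) ^ (g + p) = 2 ^ g * 2 ^ p := pow_add _ _ _
  rcases hC with hCc | hCs
  · -- a coarse addend: pattern (B′)
    right; right
    have hMt : (2:ℤ) ^ (t + 1) ∣ M := by
      rw [hM]; exact Dvd.dvd.mul_left (pow_dvd_pow 2 (by omega)) _
    have hkt : k ≤ t := by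
      by_contra hkt
      have h1 : (2:ℤ) ^ (t + 1) ∣ P := (pow_dvd_pow 2 (by omega)).trans hkP
      have h2 : (2:ℤ) ^ (t + 1) ∣ P + C - M := dvd_sub (dvd_add h1 hCc) hMt
      have h3 := (Int.le_of_dvd (abs_pos.mpr hN0) ((dvd_abs _ _).mpr h2)).trans hNle
      have h4 : (2:ℤ) ^ t < 2 ^ (t + 1) := pow_lt_pow_right₀ (by norm_num) (by omega)
      exact absurd h3 (not_le.mpr h4)
    -- `|C - M| ≤ |N| + |P|`
    have hCM : |C - M| ≤ 2 ^ t + |P| := by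
      have e : C - M = (P + C - M) - P := by ring
      rw [e]; exact (abs_sub _ _).trans (add_le_add hNle le_rfl)
    have hkt' : k = t := by
      by_contra hne
      have hk1 : k + 1 ≤ t := by omega
      have h2k : 2 * (2:ℤ) ^ k ≤ 2 ^ t := by
        calc 2 * (2:ℤ) ^ k = 2 ^ (k + 1) := by rw [pow_succ]; ring
          _ ≤ 2 ^ t := pow_le_pow_right₀ (by norm_num) hk1
      -- `2 |C - M| ≤ 2·2^t + (2^p-1)²·2^t < 2^(g+1) = 2·2^g`
      have h1 : 2 * |C - M| < 2 * 2 ^ g := by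
        have e2 : 2 * (2:ℤ) ^ g = 2 ^ (g + 1) := by rw [pow_succ]; ring
        rw [e2, eg1]
        nlinarith [hCM, hPle, sq_nonneg ((2:ℤ) ^ p - 1), mul_pos ht0 hp0]
      linarith
    subst hkt'
    -- `N = ε·2^k`
    have hNd : (2:ℤ) ^ k ∣ P + C - M :=
      dvd_sub (dvd_add hkP ((pow_dvd_pow 2 (by omega)).trans hCc))
        ((pow_dvd_pow 2 (by omega)).trans hMt)
    obtain ⟨ε, hε⟩ := hNd
    have hε1 : ε = 1 ∨ ε = -1 := by
      have h1 : |ε| ≤ 1 := by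
        have h2 : (2:ℤ) ^ k * |ε| ≤ 2 ^ k * 1 := by
          rw [mul_one, ← abs_of_pos ht0, ← abs_mul, ← hε]; rw [abs_of_pos ht0]; exact hNle
        exact le_of_mul_le_mul_left h2 ht0
      have h3 : ε ≠ 0 := by rintro rfl; simp at hε; exact hN0 hε
      rcases abs_le.mp h1 with ⟨h4, h5⟩
      omega
    -- `|C - M| < 2^(g+1)` and `C > 0`
    have hCMlt : |C - M| < 2 * 2 ^ g := by
      have e2 : 2 * (2:ℤ) ^ g = 2 ^ (g + 1) := by rw [pow_succ]; ring
      rw [e2, eg1]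
      have h1 : |C - M| ≤ 2 ^ k + ((2:ℤ) ^ p - 1) ^ 2 * 2 ^ k := hCM.trans (add_le_add le_rfl hPle)
      nlinarith [mul_pos ht0 hp0]
    have hCpos : 0 < C := by
      have h1 := (abs_lt.mp hCMlt).1
      nlinarith [hMge, egp]
    -- `2^g ∣ C`: a finer addend would be too small (`c₁ < 2^p`, `p ≥ 2`)
    have hCabs : C = c₁ * 2 ^ γ := by rw [← hC1, abs_of_pos hCpos]
    have hγg : g ≤ γ := by
      by_contra hγg
      have h1 : 2 * (2:ℤ) ^ γ ≤ 2 ^ g := by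
        calc 2 * (2:ℤ) ^ γ = 2 ^ (γ + 1) := by rw [pow_succ]; ring
          _ ≤ 2 ^ g := pow_le_pow_right₀ (by norm_num) (by omega)
      have h2 : 2 * C ≤ (2 ^ p - 1) * 2 ^ g := by
        rw [hCabs]
        have hc0 : 0 ≤ c₁ := by nlinarith
        nlinarith
      have h3 := (abs_lt.mp hCMlt).1
      nlinarith [hMge, egp]
    have hgC : (2:ℤ) ^ g ∣ C := by
      rw [hCabs]; exact Dvd.dvd.mul_left (pow_dvd_pow 2 hγg) _
    have hgM : (2:ℤ) ^ g ∣ M := by rw [hM]; exact Dvd.intro_left _ rfl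
    obtain ⟨σ, hσ⟩ := dvd_sub hgC hgM
    have hσ1 : σ = 1 ∨ σ = -1 := by
      have h1 : 1 ≤ |σ| := by
        have h2 : (2:ℤ) ^ g * 1 ≤ 2 ^ g * |σ| := by
          rw [mul_one, ← abs_of_pos hg0, ← abs_mul, ← hσ, abs_of_pos hg0]; exact hfar
        exact le_of_mul_le_mul_left h2 hg0
      have h3 : |σ| < 2 := by
        have h4 : (2:ℤ) ^ g * |σ| < 2 ^ g * 2 := by
          rw [← abs_of_pos hg0, ← abs_mul, ← hσ, abs_of_pos hg0]; linarith
        exact lt_of_mul_lt_mul_left h4 hg0.le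
      rcases le_or_gt 0 σ with h5 | h5
      · rw [abs_of_nonneg h5] at h1 h3; omega
      · rw [abs_of_neg h5] at h1 h3; omega
    refine ⟨σ, ε, hσ1, hε1, by linarith, ?_, rfl⟩
    have e : P = (P + C - M) - (C - M) := by ring
    rw [e, hε, hσ]; ring
  · -- a small addend: patterns (A1) / (A2)
    have hN := abs_le.mp hNle
    have hC' := abs_le.mp hCs
    have hPge : (2:ℤ) ^ (g + p) - 2 ^ p * 2 ^ t ≤ P := by linarith [hN.1, hC'.2]
    have hk : t + p ≤ k := by
      by_contra hk
      have h2k : 2 * (2:ℤ) ^ k ≤ 2 ^ (t + p) := by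
        calc 2 * (2:ℤ) ^ k = 2 ^ (k + 1) := by rw [pow_succ]; ring
          _ ≤ 2 ^ (t + p) := pow_le_pow_right₀ (by norm_num) (by omega)
      have h1 : 2 * P ≤ ((2:ℤ) ^ p - 1) ^ 2 * 2 ^ (t + p) :=
        calc 2 * P ≤ 2 * (((2:ℤ) ^ p - 1) ^ 2 * 2 ^ k) := by linarith [le_abs_self P]
          _ = ((2:ℤ) ^ p - 1) ^ 2 * (2 * 2 ^ k) := by ring
          _ ≤ ((2:ℤ) ^ p - 1) ^ 2 * 2 ^ (t + p) := mul_le_mul_of_nonneg_left h2k (sq_nonneg _)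
      have e1 : (2:ℤ) ^ (g + p) * 2 = 2 ^ t * 2 ^ p * (2 ^ p * 2 ^ p) := by
        rw [egp, mul_comm (2 ^ g : ℤ) _, mul_assoc, show (2:ℤ) ^ g * 2 = 2 ^ (g + 1) by
          rw [pow_succ], eg1]; ring
      have e2 : (2:ℤ) ^ (t + p) = 2 ^ t * 2 ^ p := pow_add _ _ _
      rw [e2] at h1
      have hA : (0:ℤ) < 2 ^ t * 2 ^ p := mul_pos ht0 hp0
      have hA4 : 4 * (2 ^ t * 2 ^ p) ≤ 2 ^ p * ((2:ℤ) ^ t * 2 ^ p) :=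
        mul_le_mul_of_nonneg_right h4p hA.le
      have key : 2 * (2 ^ p * ((2:ℤ) ^ t * 2 ^ p)) ≤ 3 * (2 ^ t * 2 ^ p) := by
        linarith [h1, hPge, e1]
      linarith [hA, hA4, key]
    have h1 : (2:ℤ) ^ (t + p) ∣ P := (pow_dvd_pow 2 hk).trans hkP
    have h2 : (2:ℤ) ^ (t + p) ∣ M := by
      rw [hM]; exact Dvd.dvd.mul_left (pow_dvd_pow 2 (by omega)) _
    obtain ⟨w, hw⟩ := dvd_sub h1 h2
    have htp0 : (0:ℤ) < 2 ^ (t + p) := by positivity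
    have e3 : (2:ℤ) ^ (t + p) = 2 ^ p * 2 ^ t := by rw [pow_add]; ring
    have hwle : |w| ≤ 1 := by
      have h3 : |P - M| ≤ (2:ℤ) ^ (t + p) := by
        have e : P - M = (P + C - M) - C := by ring
        rw [e, e3]
        calc |P + C - M - C| ≤ |P + C - M| + |C| := abs_sub _ _
          _ ≤ 2 ^ t + ((2:ℤ) ^ p - 1) * 2 ^ t := add_le_add hNle hCs
          _ = 2 ^ p * 2 ^ t := by ring
      have h4 : (2:ℤ) ^ (t + p) * |w| ≤ 2 ^ (t + p) * 1 := by
        rw [mul_one, ← abs_of_pos htp0, ← abs_mul, ← hw, abs_of_pos htp0]; exact h3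
      exact le_of_mul_le_mul_left h4 htp0
    rcases abs_le.mp hwle with ⟨hw1, hw2⟩
    have hw3 : w = 0 ∨ w = -1 ∨ w = 1 := by omega
    rcases hw3 with rfl | hwρ
    · left; linear_combination hw
    · right; left
      -- `P - M = -ρ·2^(t+p)` with `ρ = -w`; then `|C| ≤ (2^p-1)·2^t` forces `N = -ρ·2^t`
      refine ⟨-w, by omega, by linear_combination hw, ?_⟩
      have hCeq : C = (P + C - M) - w * 2 ^ (t + p) := by linear_combination (-1:ℤ) * hw
      rw [e3] at hCeq
      rcases hwρ with hw0 | hw0 <;> rw [hw0] at hCeq ⊢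
      · have hNeq : P + C - M = -(2 ^ t) := by linarith [hC'.2, hN.1]
        rw [hCeq, hNeq]; ring
      · have hNeq : P + C - M = 2 ^ t := by linarith [hC'.1, hN.2]
        rw [hCeq, hNeq]; ring

end Summit.Ventures.CertifiedArithmetic
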